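import Literature.NumberTheory.Transcendental.SemialgebraicLineDeriv
import Literature.NumberTheory.Transcendental.KZLogCalculusProofs
import Mathlib.Analysis.Analytic.Constructions
import Mathlib.Analysis.Calculus.FDeriv.Analytic
import HarnessLib

/-!
# Slab charts over a base chart

For Jung's projection method one parametrises the *slab* between two consecutive real walls
`lo < hi` (functions of the base point) over the image of a base chart `φ` by the open unit cube one
dimension up:
`Ψ(z) = (φ(z'), lo(z') + z_d · (hi(z') − lo(z')))`, `z = (z', z_d) ∈ ℝᵈ × ℝ`
(last coordinate distinguished through `Fin.init` / `Fin.snoc` / `Fin.last`, as everywhere in the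
tree's semialgebraic calculus). This file records the chart-format bookkeeping of such maps:

* `hasFDerivAt_snoc_init` — the derivative of `z ↦ (F(z'), h(z))` and its Jacobian determinant
  `det DF(z') · ∂h/∂z_d` (block lower-triangular, `LinearMap.det_of_snoc_init`);
* `slabChart_format` — if `φ` is analytic at the closed cube, `ℚ`-semialgebraic, injective and with
  non-vanishing Jacobian on the open cube, and `lo`, `hi` are analytic at the closed cube,
  `ℚ`-semialgebraic on the open cube with `lo < hi` there, then `Ψ` has the same format one
  dimension up, with `det DΨ(z) = det Dφ(z') · (hi − lo)(z')` (`det_fderiv_slabChart`);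
* `image_slabChart` — `Ψ` maps the open cube onto the open slab
  `{(φ x, t) | x ∈ (0,1)ᵈ, lo x < t < hi x}`;
* `format_comp_continuousLinearEquiv` — the format is stable under post-composition with a
  `ℚ`-semialgebraic linear automorphism (used for rational shears).

## References

* H. W. E. Jung, J. reine angew. Math. 133 (1908), 289–314 (projection method).
* J. Kollár, *Lectures on Resolution of Singularities* (2007), §2.3.
* J. Bochnak, M. Coste, M.-F. Roy, *Real Algebraic Geometry* (1998), §2.2 (semialgebraic maps).
-/

noncomputable section

open Set
open Literature.ModelTheory.ExponentialFields

namespace Literature.NumberTheory.Transcendental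

variable {d : ℕ}

/-! ### The Jacobian of `z ↦ (F (init z), h z)` -/

/-- **Derivative and Jacobian of `z ↦ (F(z'), h(z))`.** If `F : ℝᵈ → ℝᵈ` has derivative `F'` at
`z' = init z` and `h : ℝᵈ⁺¹ → ℝ` has derivative `h'` at `z`, then `z ↦ Fin.snoc (F (init z)) (h z)`
has a derivative `Ψ'` at `z` with `det Ψ' = det F' · h'(e_d)` (`e_d` the last basis vector): the
Jacobian matrix is block lower-triangular. [folklore] -/
theorem hasFDerivAt_snoc_init {F : (Fin d → ℝ) → (Fin d → ℝ)} {h : (Fin (d + 1) → ℝ) → ℝ}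
    {z : Fin (d + 1) → ℝ} {F' : (Fin d → ℝ) →L[ℝ] (Fin d → ℝ)} {h' : (Fin (d + 1) → ℝ) →L[ℝ] ℝ}
    (hF : HasFDerivAt F F' (Fin.init z)) (hh : HasFDerivAt h h' z) :
    ∃ Ψ' : (Fin (d + 1) → ℝ) →L[ℝ] (Fin (d + 1) → ℝ),
      HasFDerivAt (fun z => (Fin.snoc (F (Fin.init z)) (h z) : Fin (d + 1) → ℝ)) Ψ' z ∧
      (∀ v, Ψ' v = Fin.snoc (F' (Fin.init v)) (h' v)) ∧
      Ψ'.det = F'.det * h' (Pi.single (Fin.last d) 1) := by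
  classical
  -- `init` as a continuous linear map
  let initL : (Fin (d + 1) → ℝ) →L[ℝ] (Fin d → ℝ) :=
    ContinuousLinearMap.pi fun j => ContinuousLinearMap.proj (Fin.castSucc j)
  have hinitL : ∀ v, initL v = Fin.init v := fun v => rfl
  let Ψ' : (Fin (d + 1) → ℝ) →L[ℝ] (Fin (d + 1) → ℝ) :=
    ContinuousLinearMap.pi (Fin.lastCases (motive := fun _ => (Fin (d + 1) → ℝ) →L[ℝ] ℝ) h'
      (fun j => (ContinuousLinearMap.proj j).comp (F'.comp initL)))
  have hΨ' : ∀ v, Ψ' v = Fin.snoc (F' (Fin.init v)) (h' v) := by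
    intro v
    funext i
    refine Fin.lastCases ?_ (fun j => ?_) i
    · simp [Ψ']
    · simp [Ψ', hinitL]
  refine ⟨Ψ', ?_, hΨ', ?_⟩
  · rw [hasFDerivAt_pi']
    intro i
    refine Fin.lastCases ?_ (fun j => ?_) i
    · have hfun : (fun x => (Fin.snoc (F (Fin.init x)) (h x) : Fin (d + 1) → ℝ) (Fin.last d)) = h :=
        funext fun x => by simp
      rw [hfun]
      refine hh.congr_fderiv (ContinuousLinearMap.ext fun v => ?_)
      simp [hΨ']
    · have hfun : (fun x => (Fin.snoc (F (Fin.init x)) (h x) : Fin (d + 1) → ℝ) (Fin.castSucc j)) =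
          (fun y : Fin d → ℝ => y j) ∘ F ∘ initL := funext fun x => by simp [hinitL]
      rw [hfun]
      have h1 : HasFDerivAt (F ∘ initL) (F'.comp initL) z :=
        (hinitL z ▸ hF).comp z initL.hasFDerivAt
      refine ((hasFDerivAt_apply j (F (initL z))).comp z h1).congr_fderiv
        (ContinuousLinearMap.ext fun v => ?_)
      simp [hΨ', hinitL]
  · -- `h' v = ℓ (init v) + c * v_last` with `ℓ = h' ∘ (snoc · 0)`, `c = h' e_d`
    let E : (Fin d → ℝ) →ₗ[ℝ] (Fin (d + 1) → ℝ) :=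
      LinearMap.pi (Fin.lastCases (motive := fun _ => (Fin d → ℝ) →ₗ[ℝ] ℝ) 0
        (fun j => LinearMap.proj j))
    have hE : ∀ x, E x = Fin.snoc x 0 := by
      intro x
      funext i
      refine Fin.lastCases ?_ (fun j => ?_) i <;> simp [E]
    have hsplit : ∀ v : Fin (d + 1) → ℝ,
        v = Fin.snoc (Fin.init v) 0 + v (Fin.last d) • (Pi.single (Fin.last d) (1 : ℝ)) := by
      intro v
      funext i
      refine Fin.lastCases ?_ (fun j => ?_) i
      · simp
      · simp [Fin.init, (Fin.castSucc_lt_last j).ne]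
    have h := LinearMap.det_of_snoc_init (Ψ' : (Fin (d + 1) → ℝ) →ₗ[ℝ] (Fin (d + 1) → ℝ))
      (F' : (Fin d → ℝ) →ₗ[ℝ] (Fin d → ℝ)) ((h' : (Fin (d + 1) → ℝ) →ₗ[ℝ] ℝ).comp E)
      (h' (Pi.single (Fin.last d) 1)) (fun v => by
        rw [ContinuousLinearMap.coe_coe, hΨ']
        congr 1
        rw [LinearMap.comp_apply, hE, ContinuousLinearMap.coe_coe, mul_comm]
        conv_lhs => rw [hsplit v]
        rw [map_add, map_smul, smul_eq_mul])
    rw [ContinuousLinearMap.det, h, mul_comm]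

/-! ### The slab chart -/

section Slab

variable (φ : (Fin d → ℝ) → (Fin d → ℝ)) (lo hi : (Fin d → ℝ) → ℝ)
  (Ψ : (Fin (d + 1) → ℝ) → (Fin (d + 1) → ℝ))

/-- Points of the closed cube of `ℝᵈ⁺¹` have their first `d` coordinates in the closed cube of
`ℝᵈ`. [folklore] -/
theorem init_mem_pi_Icc {z : Fin (d + 1) → ℝ}
    (hz : z ∈ Set.pi Set.univ (fun _ : Fin (d + 1) => Icc (0 : ℝ) 1)) :
    Fin.init z ∈ Set.pi Set.univ (fun _ : Fin d => Icc (0 : ℝ) 1) :=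
  fun j _ => hz (Fin.castSucc j) (mem_univ _)

/-- Points of the open cube of `ℝᵈ⁺¹` have their first `d` coordinates in the open cube of `ℝᵈ`.
[folklore] -/
theorem init_mem_pi_Ioo {z : Fin (d + 1) → ℝ}
    (hz : z ∈ Set.pi Set.univ (fun _ : Fin (d + 1) => Ioo (0 : ℝ) 1)) :
    Fin.init z ∈ Set.pi Set.univ (fun _ : Fin d => Ioo (0 : ℝ) 1) :=
  fun j _ => hz (Fin.castSucc j) (mem_univ _)

/-- The open cube is contained in the closed cube. [folklore] -/
theorem pi_Ioo_subset_pi_Icc (n : ℕ) :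
    Set.pi Set.univ (fun _ : Fin n => Ioo (0 : ℝ) 1) ⊆ Set.pi Set.univ (fun _ : Fin n => Icc (0 : ℝ) 1) :=
  Set.pi_mono fun _ _ => Ioo_subset_Icc_self

/-- The open unit cube is `ℚ`-semialgebraic. [cite: KontsevichZagier2001, §1.1] -/
theorem isSemialgebraic_pi_Ioo_unit (n : ℕ) :
    IsSemialgebraic ℚ (Set.pi Set.univ (fun _ : Fin n => Ioo (0 : ℝ) 1)) := by
  have h : Set.pi Set.univ (fun _ : Fin n => Ioo (0 : ℝ) 1) =
      ⋂ j ∈ (Finset.univ : Finset (Fin n)),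
        ({x : Fin n → ℝ | 0 < MvPolynomial.aeval x (MvPolynomial.X j : MvPolynomial (Fin n) ℚ)} ∩
          {x | 0 < MvPolynomial.aeval x (1 - MvPolynomial.X j : MvPolynomial (Fin n) ℚ)}) := by
    ext x
    simp [Set.mem_pi, sub_pos]
  rw [h]
  exact IsSemialgebraic.biInter _ _ fun j _ =>
    (isSemialgebraic_setOf_eval_pos _).inter (isSemialgebraic_setOf_eval_pos _)

/-- The derivative of the height function `h(z) = lo(z') + z_d (hi(z') − lo(z'))` of a slab chart,
and its value `hi(z') − lo(z')` on the last basis vector. [folklore] -/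
theorem hasFDerivAt_slabHeight {z : Fin (d + 1) → ℝ} (hlo : DifferentiableAt ℝ lo (Fin.init z))
    (hhi : DifferentiableAt ℝ hi (Fin.init z)) :
    ∃ h' : (Fin (d + 1) → ℝ) →L[ℝ] ℝ,
      HasFDerivAt (fun z : Fin (d + 1) → ℝ =>
        lo (Fin.init z) + z (Fin.last d) * (hi (Fin.init z) - lo (Fin.init z))) h' z ∧
      h' (Pi.single (Fin.last d) 1) = hi (Fin.init z) - lo (Fin.init z) := by
  let initL : (Fin (d + 1) → ℝ) →L[ℝ] (Fin d → ℝ) :=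
    ContinuousLinearMap.pi fun j => ContinuousLinearMap.proj (Fin.castSucc j)
  have hinitL : ∀ v, initL v = Fin.init v := fun v => rfl
  have hlo' : HasFDerivAt (fun z : Fin (d + 1) → ℝ => lo (Fin.init z))
      ((fderiv ℝ lo (Fin.init z)).comp initL) z :=
    (hinitL z ▸ hlo.hasFDerivAt).comp z initL.hasFDerivAt
  have hhi' : HasFDerivAt (fun z : Fin (d + 1) → ℝ => hi (Fin.init z))
      ((fderiv ℝ hi (Fin.init z)).comp initL) z :=
    (hinitL z ▸ hhi.hasFDerivAt).comp z initL.hasFDerivAt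
  have hlast : HasFDerivAt (fun z : Fin (d + 1) → ℝ => z (Fin.last d))
      (ContinuousLinearMap.proj (Fin.last d)) z := hasFDerivAt_apply (𝕜 := ℝ) (Fin.last d) z
  refine ⟨_, hlo'.add (hlast.mul (hhi'.sub hlo')), ?_⟩
  have h0 : initL (Pi.single (Fin.last d) 1) = 0 := by
    rw [hinitL]
    funext j
    simp [Fin.init, (Fin.castSucc_lt_last j).ne]
  simp [h0]

/-- **Jacobian of a slab chart**: for `Ψ(z) = (φ(z'), lo(z') + z_d (hi(z') − lo(z')))` with `φ`,
`lo`, `hi` differentiable at `z' = init z`,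
`det DΨ(z) = det Dφ(z') · (hi(z') − lo(z'))`. [folklore] -/
theorem det_fderiv_slabChart
    (hΨ : ∀ z, Ψ z = Fin.snoc (φ (Fin.init z))
      (lo (Fin.init z) + z (Fin.last d) * (hi (Fin.init z) - lo (Fin.init z))))
    {z : Fin (d + 1) → ℝ} (hφ : DifferentiableAt ℝ φ (Fin.init z))
    (hlo : DifferentiableAt ℝ lo (Fin.init z)) (hhi : DifferentiableAt ℝ hi (Fin.init z)) :
    DifferentiableAt ℝ Ψ z ∧
      (fderiv ℝ Ψ z).det = (fderiv ℝ φ (Fin.init z)).det * (hi (Fin.init z) - lo (Fin.init z)) := by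
  obtain ⟨h', hh', hval⟩ := hasFDerivAt_slabHeight lo hi hlo hhi
  obtain ⟨Ψ', hΨ', -, hdet⟩ := hasFDerivAt_snoc_init hφ.hasFDerivAt hh'
  have hfun : Ψ = fun z => Fin.snoc (φ (Fin.init z))
      (lo (Fin.init z) + z (Fin.last d) * (hi (Fin.init z) - lo (Fin.init z))) := funext hΨ
  rw [hfun]
  exact ⟨hΨ'.differentiableAt, by rw [hΨ'.fderiv, hdet, hval]⟩

/-- **Image of a slab chart**: `Ψ` maps the open unit cube of `ℝᵈ⁺¹` onto the open slab
`{(φ x, t) | x ∈ (0,1)ᵈ, lo x < t < hi x}` when `lo < hi` on the open cube. [folklore] -/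
theorem image_slabChart
    (hΨ : ∀ z, Ψ z = Fin.snoc (φ (Fin.init z))
      (lo (Fin.init z) + z (Fin.last d) * (hi (Fin.init z) - lo (Fin.init z))))
    (hlt : ∀ x ∈ Set.pi Set.univ (fun _ : Fin d => Ioo (0 : ℝ) 1), lo x < hi x) :
    Ψ '' Set.pi Set.univ (fun _ : Fin (d + 1) => Ioo (0 : ℝ) 1) =
      {u : Fin (d + 1) → ℝ | ∃ x ∈ Set.pi Set.univ (fun _ : Fin d => Ioo (0 : ℝ) 1),
        Fin.init u = φ x ∧ u (Fin.last d) ∈ Ioo (lo x) (hi x)} := by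
  ext u
  simp only [mem_image, mem_setOf_eq]
  constructor
  · rintro ⟨z, hz, rfl⟩
    have hz' := init_mem_pi_Ioo hz
    have hgap := sub_pos.2 (hlt _ hz')
    have hw : z (Fin.last d) ∈ Ioo (0 : ℝ) 1 := hz (Fin.last d) (mem_univ _)
    refine ⟨Fin.init z, hz', by rw [hΨ, Fin.init_snoc], ?_⟩
    rw [hΨ, Fin.snoc_last]
    constructor
    · have := mul_pos hw.1 hgap
      linarith
    · have := mul_lt_of_lt_one_left hgap hw.2
      linarith
  · rintro ⟨x, hx, hinit, ht⟩
    have hgap := sub_pos.2 (hlt _ hx)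
    refine ⟨Fin.snoc x ((u (Fin.last d) - lo x) / (hi x - lo x)), ?_, ?_⟩
    · intro i _
      refine Fin.lastCases ?_ (fun j => ?_) i
      · rw [Fin.snoc_last]
        exact ⟨div_pos (sub_pos.2 ht.1) hgap, (div_lt_one hgap).2 (by linarith [ht.2])⟩
      · rw [Fin.snoc_castSucc]
        exact hx j (mem_univ _)
    · rw [hΨ, Fin.init_snoc, Fin.snoc_last, ← hinit, div_mul_cancel₀ _ hgap.ne', add_sub_cancel,
        Fin.snoc_init_self]

/-- **Format of a slab chart.** If the base chart `φ : ℝᵈ → ℝᵈ` is analytic at every point of the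
closed unit cube and, on the open unit cube, `ℚ`-semialgebraic, injective and with non-vanishing
Jacobian, and the walls `lo < hi` (on the open cube) are analytic at the closed cube and
`ℚ`-semialgebraic on the open cube, then the slab chart
`Ψ(z) = (φ(z'), lo(z') + z_d (hi(z') − lo(z')))` is analytic at the closed unit cube of `ℝᵈ⁺¹`
and, on its open cube, `ℚ`-semialgebraic, injective and with non-vanishing Jacobian.
[cite: BochnakCosteRoy1998, §2.2] -/
theorem slabChart_format
    (hΨ : ∀ z, Ψ z = Fin.snoc (φ (Fin.init z))
      (lo (Fin.init z) + z (Fin.last d) * (hi (Fin.init z) - lo (Fin.init z))))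
    (hφa : AnalyticOnNhd ℝ φ (Set.pi Set.univ (fun _ : Fin d => Icc (0 : ℝ) 1)))
    (hφs : IsSemialgebraicMapOn ℚ (Set.pi Set.univ (fun _ : Fin d => Ioo (0 : ℝ) 1)) φ)
    (hφi : InjOn φ (Set.pi Set.univ (fun _ : Fin d => Ioo (0 : ℝ) 1)))
    (hφd : ∀ x ∈ Set.pi Set.univ (fun _ : Fin d => Ioo (0 : ℝ) 1), (fderiv ℝ φ x).det ≠ 0)
    (hloa : AnalyticOnNhd ℝ lo (Set.pi Set.univ (fun _ : Fin d => Icc (0 : ℝ) 1)))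
    (hhia : AnalyticOnNhd ℝ hi (Set.pi Set.univ (fun _ : Fin d => Icc (0 : ℝ) 1)))
    (hlos : IsSemialgebraicFunOn ℚ (Set.pi Set.univ (fun _ : Fin d => Ioo (0 : ℝ) 1)) lo)
    (hhis : IsSemialgebraicFunOn ℚ (Set.pi Set.univ (fun _ : Fin d => Ioo (0 : ℝ) 1)) hi)
    (hlt : ∀ x ∈ Set.pi Set.univ (fun _ : Fin d => Ioo (0 : ℝ) 1), lo x < hi x) :
    AnalyticOnNhd ℝ Ψ (Set.pi Set.univ (fun _ : Fin (d + 1) => Icc (0 : ℝ) 1)) ∧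
      IsSemialgebraicMapOn ℚ (Set.pi Set.univ (fun _ : Fin (d + 1) => Ioo (0 : ℝ) 1)) Ψ ∧
      InjOn Ψ (Set.pi Set.univ (fun _ : Fin (d + 1) => Ioo (0 : ℝ) 1)) ∧
      ∀ z ∈ Set.pi Set.univ (fun _ : Fin (d + 1) => Ioo (0 : ℝ) 1), (fderiv ℝ Ψ z).det ≠ 0 := by
  have hfun : Ψ = fun z => Fin.snoc (φ (Fin.init z))
      (lo (Fin.init z) + z (Fin.last d) * (hi (Fin.init z) - lo (Fin.init z))) := funext hΨ
  let initL : (Fin (d + 1) → ℝ) →L[ℝ] (Fin d → ℝ) :=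
    ContinuousLinearMap.pi fun j => ContinuousLinearMap.proj (Fin.castSucc j)
  have hinitL : ∀ v, initL v = Fin.init v := fun v => rfl
  have hcompa : ∀ {g : (Fin d → ℝ) → ℝ} {z : Fin (d + 1) → ℝ}, AnalyticAt ℝ g (Fin.init z) →
      AnalyticAt ℝ (fun z : Fin (d + 1) → ℝ => g (Fin.init z)) z := fun {g z} hg =>
    (hinitL z ▸ hg).comp (initL.analyticAt z)
  refine ⟨fun z hz => ?_, ?_, ?_, fun z hz => ?_⟩
  · -- analytic at the closed cube
    have hz' := init_mem_pi_Icc hz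
    rw [hfun]
    refine analyticAt_pi_iff.2 fun i => ?_
    refine Fin.lastCases ?_ (fun j => ?_) i
    · simp only [Fin.snoc_last]
      exact (hcompa (hloa _ hz')).add (((ContinuousLinearMap.proj (Fin.last d)).analyticAt z).mul
        ((hcompa (hhia _ hz')).sub (hcompa (hloa _ hz'))))
    · simp only [Fin.snoc_castSucc]
      exact hcompa (analyticAt_pi_iff.1 (hφa _ hz') j)
  · -- semialgebraic on the open cube
    have hO := isSemialgebraic_pi_Ioo_unit (d + 1)
    have hOd := isSemialgebraic_pi_Ioo_unit d
    have hsub : Set.pi Set.univ (fun _ : Fin (d + 1) => Ioo (0 : ℝ) 1) ⊆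
        {z : Fin (d + 1) → ℝ | Fin.init z ∈ Set.pi Set.univ (fun _ : Fin d => Ioo (0 : ℝ) 1)} :=
      fun z hz => init_mem_pi_Ioo hz
    have hcomp : ∀ {g : (Fin d → ℝ) → ℝ},
        IsSemialgebraicFunOn ℚ (Set.pi Set.univ (fun _ : Fin d => Ioo (0 : ℝ) 1)) g →
        IsSemialgebraicFunOn ℚ (Set.pi Set.univ (fun _ : Fin (d + 1) => Ioo (0 : ℝ) 1))
          (fun z => g (Fin.init z)) := fun hg => hg.comp_init.mono hsub hO
    refine IsSemialgebraicMapOn.of_forall hO fun i => ?_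
    refine Fin.lastCases ?_ (fun j => ?_) i
    · have hX : IsSemialgebraicFunOn ℚ (Set.pi Set.univ (fun _ : Fin (d + 1) => Ioo (0 : ℝ) 1))
          (fun z => z (Fin.last d)) :=
        (isSemialgebraicFunOn_aeval hO (MvPolynomial.X (Fin.last d))).congr fun z _ => by simp
      exact ((hcomp hlos).fun_add (hX.fun_mul ((hcomp hhis).fun_sub (hcomp hlos)))).congr
        fun z _ => by simp [hΨ]
    · exact (hcomp ((isSemialgebraicMapOn_iff_forall_holds hOd).1 hφs j)).congr
        fun z _ => by simp [hΨ]
  · -- injective on the open cube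
    intro z hz z' hz' heq
    rw [hΨ, hΨ] at heq
    have h1 : φ (Fin.init z) = φ (Fin.init z') := by
      simpa only [Fin.init_snoc] using congrArg Fin.init heq
    have h2 := hφi (init_mem_pi_Ioo hz) (init_mem_pi_Ioo hz') h1
    have h3 := congrFun heq (Fin.last d)
    simp only [Fin.snoc_last, h2, add_right_inj] at h3
    have h4 : z (Fin.last d) = z' (Fin.last d) :=
      mul_right_cancel₀ (sub_pos.2 (hlt _ (init_mem_pi_Ioo hz'))).ne' h3
    rw [← Fin.snoc_init_self z, ← Fin.snoc_init_self z', h2, h4]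
  · -- Jacobian on the open cube
    have hz' := init_mem_pi_Ioo hz
    have hz'' := pi_Ioo_subset_pi_Icc d hz'
    rw [(det_fderiv_slabChart φ lo hi Ψ hΨ (hφa _ hz'').differentiableAt
      (hloa _ hz'').differentiableAt (hhia _ hz'').differentiableAt).2]
    exact mul_ne_zero (hφd _ hz') (sub_pos.2 (hlt _ hz')).ne'

end Slab

/-! ### Post-composition with a semialgebraic linear automorphism -/

/-- **The chart format is stable under rational linear changes of coordinates.** If `Ψ` is analytic
at the closed unit cube and `ℚ`-semialgebraic, injective and with non-vanishing Jacobian on the open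
unit cube, and `T` is a continuous linear automorphism of `ℝⁿ` which is a `ℚ`-semialgebraic map
(e.g. given by a rational matrix), then `T ∘ Ψ` has the same format. [cite: BochnakCosteRoy1998, §2.2] -/
theorem format_comp_continuousLinearEquiv {n : ℕ} (T : (Fin n → ℝ) ≃L[ℝ] (Fin n → ℝ))
    (hT : IsSemialgebraicMapOn ℚ (Set.univ : Set (Fin n → ℝ)) T)
    {Ψ : (Fin n → ℝ) → (Fin n → ℝ)}
    (ha : AnalyticOnNhd ℝ Ψ (Set.pi Set.univ (fun _ : Fin n => Icc (0 : ℝ) 1)))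
    (hs : IsSemialgebraicMapOn ℚ (Set.pi Set.univ (fun _ : Fin n => Ioo (0 : ℝ) 1)) Ψ)
    (hi : InjOn Ψ (Set.pi Set.univ (fun _ : Fin n => Ioo (0 : ℝ) 1)))
    (hd : ∀ z ∈ Set.pi Set.univ (fun _ : Fin n => Ioo (0 : ℝ) 1), (fderiv ℝ Ψ z).det ≠ 0) :
    AnalyticOnNhd ℝ (T ∘ Ψ) (Set.pi Set.univ (fun _ : Fin n => Icc (0 : ℝ) 1)) ∧
      IsSemialgebraicMapOn ℚ (Set.pi Set.univ (fun _ : Fin n => Ioo (0 : ℝ) 1)) (T ∘ Ψ) ∧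
      InjOn (T ∘ Ψ) (Set.pi Set.univ (fun _ : Fin n => Ioo (0 : ℝ) 1)) ∧
      ∀ z ∈ Set.pi Set.univ (fun _ : Fin n => Ioo (0 : ℝ) 1), (fderiv ℝ (T ∘ Ψ) z).det ≠ 0 := by
  refine ⟨fun z hz => ((T : (Fin n → ℝ) →L[ℝ] (Fin n → ℝ)).analyticAt _).comp (ha z hz), ?_,
    T.injective.comp_injOn hi, fun z hz => ?_⟩
  · exact IsSemialgebraicMapOn.comp_holds hT hs (mapsTo_univ _ _)
  · have hΨ : DifferentiableAt ℝ Ψ z :=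
      (ha z (pi_Ioo_subset_pi_Icc n hz)).differentiableAt
    have hcomp : HasFDerivAt (T ∘ Ψ)
        ((T : (Fin n → ℝ) →L[ℝ] (Fin n → ℝ)).comp (fderiv ℝ Ψ z)) z :=
      (T : (Fin n → ℝ) →L[ℝ] (Fin n → ℝ)).hasFDerivAt.comp z hΨ.hasFDerivAt
    rw [hcomp.fderiv, ContinuousLinearMap.det]
    have h1 : ((T : (Fin n → ℝ) →L[ℝ] (Fin n → ℝ)).comp (fderiv ℝ Ψ z) :
        (Fin n → ℝ) →ₗ[ℝ] (Fin n → ℝ)) =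
        ((T : (Fin n → ℝ) ≃ₗ[ℝ] (Fin n → ℝ)) : (Fin n → ℝ) →ₗ[ℝ] (Fin n → ℝ)).comp
          (fderiv ℝ Ψ z : (Fin n → ℝ) →ₗ[ℝ] (Fin n → ℝ)) := rfl
    rw [h1, LinearMap.det_comp]
    refine mul_ne_zero ?_ (hd z hz)
    exact (LinearEquiv.isUnit_det' (T : (Fin n → ℝ) ≃ₗ[ℝ] (Fin n → ℝ))).ne_zero

end Literature.NumberTheory.Transcendental
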